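import Mathlib
import Summits.ResolutionOfSingularities.ResolutionOfSingularities.Theorems.WeightedInvariantLocalWeightedDropPolyDescentAxisVertex
import Summits.ResolutionOfSingularities.ResolutionOfSingularities.Theorems.WeightedInvariantLocalWeightedDropPolyDescentCompare
import Summits.ResolutionOfSingularities.ResolutionOfSingularities.Theorems.WeightedInvariantLocalWeightedDropWildMonicWideExit

/-!
# `WeightedInvariant.LocalWeightedDrop`, stub S3ρ, line «monic polyhedron descent», piece (ρ-B) part (B-iii): THE TWO EXITS OF THE GAME BRIDGE
# that well-preparedness pays for — NOT WIDE, and ROW TRANSFER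

Crux item stmt-ResolutionOfSingularities-8899 `LocalWeightedDrop` (route `ResolutionOfSingularities/WeightedInvariant`), engine skeleton v30, stub
S3ρ `stub_wildMonicSurfaceReductionWon`; line file `L/res-L1-w43-lead-1/g3/poly_descent_line_v1.lean`, sub-stub (ρ-B) `PolyDescent.stub_polyBridge`
(plan of record: res-D-pv-058's cut 08:22:18Z, adopted by the line lead 08:34:59Z — «(ρ-M)-free»).  [OURS · L1 W4.3, chain w43; res-D-pv-058
(acting as res-L1-w43-stub-6).  MODEL: CJS LNM 2270 Ch. 8/13 — at a near point of a WELL-PREPARED form the new coordinates are again a position,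
and the curve `V(y, ũ₂)` of case (a″) is permissible for the prepared label; both from the axis-vertex lemma (`…PolyDescentAxisVertex`).  Nothing
here is a statement of any manuscript; no definitions.]

* `isPosT_of_wellPrepared_of_isPosT_linShift` — a WELL-PREPARED label one of whose LINEAR re-centrings `y ↦ y − Σ μ_i u_i` is a position is
  itself a position (else `(d!,0)` or `(0,d!)` is a solvable vertex);
* `won_monic_of_wellPrepared_of_not_isPosT` — THE EXIT: over `k = k̄` of characteristic `p`, given (H<d) and (Haxis), the monic germ of a
  well-prepared label that is NOT a position is won whenever singular (order `< d`: (H<d); order `d`: never wide by the previous item and 083's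
  `WildMonic.exists_linShift_isPos_of_wide`, so `WildPurePower.won_of_order_eq_of_not_wide`);
* `isPermissibleTwoT_of_wellPrepared_of_isPermissibleTwoT_shift` — ROW TRANSFER: a well-prepared label one of whose re-centrings `y ↦ y + φ`
  has `V(y,u₂)` permissible has `V(y,u₂)` permissible itself (`u₂ ∣ φ`, else the pure `u₁`-part of `φ` gives a solvable axis vertex);
  the general-degree, minimality-free form of `MonicDescent.isPermissibleTwo_of_wellPrepared_of_recentre`.
-/

set_option linter.dupNamespace false -- mandated namespace of this single-conjunct summit

namespace Summit.ResolutionOfSingularities.ResolutionOfSingularities.Theorems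

namespace PolyDescent

open MvPowerSeries MonicDescent WildMonic Literature.AlgebraicGeometry.Resolution

variable {k : Type} [Field k]

/-! ## A well-prepared label is never «wide» -/

/-- the pure coefficients of a linear form. -/
private theorem coeff_single_linForm (μ : Fin 2 → k) (l : Fin 2) (n : ℕ) :
    coeff (Finsupp.single l n) (∑ i : Fin 2, C (μ i) * (X i : MvPowerSeries (Fin 2) k)) = if n = 1 then μ l else 0 := by
  classical
  rw [map_sum]
  simp_rw [coeff_C_mul, coeff_X]
  split_ifs with hn
  · subst hn
    rw [Finset.sum_eq_single l]
    · rw [if_pos rfl, mul_one]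
    · intro i _ hil
      rw [if_neg (fun h => hil ?_), mul_zero]
      rcases (Finsupp.single_eq_single_iff _ _ _ _).mp h with ⟨h1, -⟩ | ⟨h1, -⟩
      · exact h1.symm
      · exact absurd h1 one_ne_zero
    · intro h; exact absurd (Finset.mem_univ l) h
  · exact Finset.sum_eq_zero fun i _ => by
      rw [if_neg (fun h => ?_), mul_zero]
      rcases (Finsupp.single_eq_single_iff _ _ _ _).mp h with ⟨-, h1⟩ | ⟨-, h1⟩
      · exact hn h1
      · exact one_ne_zero h1

/-- **A well-prepared label one of whose LINEAR re-centrings is a position is a position** (`d ≥ 1`). -/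
theorem isPosT_of_wellPrepared_of_isPosT_linShift {d : ℕ} (hd : 0 < d) {T : Fin d → MvPowerSeries (Fin 2) k}
    (hWP : WellPrepared d T) (μ : Fin 2 → k) (hpos : IsPosT d (shift d T (-(∑ i : Fin 2, C (μ i) * (X i : MvPowerSeries (Fin 2) k))))) :
    IsPosT d T := by
  classical
  set φ : MvPowerSeries (Fin 2) k := -(∑ i : Fin 2, C (μ i) * (X i : MvPowerSeries (Fin 2) k)) with hφ
  by_cases hμ : ∀ l, μ l = 0
  · have h0 : φ = 0 := by
      rw [hφ, neg_eq_zero]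
      exact Finset.sum_eq_zero fun i _ => by rw [hμ i, map_zero, zero_mul]
    rw [h0, shift_zero'] at hpos
    exact hpos
  · exfalso
    push Not at hμ
    obtain ⟨l, hl⟩ := hμ
    set S := shift d T φ with hS
    have hT : T = shift d S (-φ) := by rw [hS, shift_shift_neg]
    refine (not_wellPrepared_shift_of_axis l hd S (-φ) 1 (fun n hn => ?_) ?_ (fun i n hn => ?_)) (hT ▸ hWP)
    · have hn0 : n = 0 := by omega
      subst hn0
      rw [hφ, neg_neg, coeff_single_linForm, if_neg (by omega)]
    · rw [hφ, neg_neg, coeff_single_linForm, if_pos rfl]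
      exact hl
    · exact coeff_of_lt_order (lt_of_le_of_lt (by rw [Finsupp.degree_single]; exact_mod_cast (by omega : n ≤ d - (i : ℕ))) (hpos i))

/-- **THE EXIT OF THE GAME BRIDGE**: over an algebraically closed field of characteristic `p`, given the surface germs of order `< d` (H<d) and the
order-`d` germs with a one-dimensional apex (Haxis), the monic germ of a WELL-PREPARED label that is NOT a position is won whenever singular:
its order is `< d`, or it is `d` and then the germ is not wide (`isPosT_of_wellPrepared_of_isPosT_linShift` with 083's
`exists_linShift_isPos_of_wide`), so `WildPurePower.won_of_order_eq_of_not_wide` applies. -/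
theorem won_monic_of_wellPrepared_of_not_isPosT (p : ℕ) (hp : p.Prime) (k : Type) [Field k] [CharP k p] [IsAlgClosed k] {d : ℕ}
    (hd : 0 < d)
    (hord : ∀ g : MvPowerSeries (Fin 3) k, CobordantGame.IsSingular k g → g.order < d → CobordantGame.Won k 3 g)
    (haxis : ∀ g : MvPowerSeries (Fin 3) k, CobordantGame.IsSingular k g → g.order = d →
      (∃ c : Fin 3 → k, c ≠ 0 ∧ ∀ v : Fin 3 → k,
        CobordantChart.initEval (fun _ : Fin 3 => 1) (v + c) d g = CobordantChart.initEval (fun _ : Fin 3 => 1) v d g) →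
      (∀ c₁ c₂ : Fin 3 → k,
        (∀ v : Fin 3 → k, CobordantChart.initEval (fun _ : Fin 3 => 1) (v + c₁) d g = CobordantChart.initEval (fun _ : Fin 3 => 1) v d g) →
        (∀ v : Fin 3 → k, CobordantChart.initEval (fun _ : Fin 3 => 1) (v + c₂) d g = CobordantChart.initEval (fun _ : Fin 3 => 1) v d g) →
        ∃ α β : k, (α ≠ 0 ∨ β ≠ 0) ∧ α • c₁ + β • c₂ = 0) →
      CobordantGame.Won k 3 g)
    {T : Fin d → MvPowerSeries (Fin 2) k} (hWP : WellPrepared d T) (hnpos : ¬ IsPosT d T)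
    (hsing : CobordantGame.IsSingular k ((X (Fin.last 2) : MvPowerSeries (Fin (2 + 1)) k) ^ d +
      ∑ j : Fin d, rename (Fin.succAboveEmb (Fin.last 2)) (T j) * X (Fin.last 2) ^ (j : ℕ))) :
    CobordantGame.Won k (2 + 1) ((X (Fin.last 2) : MvPowerSeries (Fin (2 + 1)) k) ^ d +
      ∑ j : Fin d, rename (Fin.succAboveEmb (Fin.last 2)) (T j) * X (Fin.last 2) ^ (j : ℕ)) := by
  set g : MvPowerSeries (Fin (2 + 1)) k := (X (Fin.last 2) : MvPowerSeries (Fin (2 + 1)) k) ^ d +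
    ∑ j : Fin d, rename (Fin.succAboveEmb (Fin.last 2)) (T j) * X (Fin.last 2) ^ (j : ℕ) with hg
  have hle : g.order ≤ (d : ℕ∞) := order_monicForm_le T
  by_cases hlt : g.order < (d : ℕ∞)
  · exact hord g hsing hlt
  have heq : g.order = (d : ℕ∞) := le_antisymm hle (not_lt.mp hlt)
  refine WildPurePower.won_of_order_eq_of_not_wide p hp k hord haxis g hsing heq ?_
  rintro ⟨c₁, c₂, hind, h₁, h₂⟩
  obtain ⟨μ, hμ⟩ := exists_linShift_isPos_of_wide k hd T (not_lt.mp hlt) c₁ c₂ hind h₁ h₂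
  exact hnpos (isPosT_of_wellPrepared_of_isPosT_linShift hd hWP μ hμ)

/-! ## Row transfer -/

/-- divisibility form of permissibility: `u₂^{d−j} ∣ A_j`. -/
theorem X_pow_dvd_of_isPermissibleTwoT {d : ℕ} {A : Fin d → MvPowerSeries (Fin 2) k} (h : IsPermissibleTwoT d A) (j : Fin d) :
    (X 1 : MvPowerSeries (Fin 2) k) ^ (d - (j : ℕ)) ∣ A j := by
  rw [X_pow_dvd_iff]
  intro e he
  by_contra hne
  exact absurd (h j e hne) (not_le.mpr he)

/-- permissibility from divisibility. -/
theorem isPermissibleTwoT_of_X_pow_dvd {d : ℕ} {A : Fin d → MvPowerSeries (Fin 2) k}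
    (h : ∀ j : Fin d, (X 1 : MvPowerSeries (Fin 2) k) ^ (d - (j : ℕ)) ∣ A j) : IsPermissibleTwoT d A := by
  intro j e he
  by_contra hlt
  exact he ((X_pow_dvd_iff.mp (h j)) e (not_le.mp hlt))

/-- **Re-centring by `φ` with `u₂ ∣ φ` keeps `V(y,u₂)` permissible** (every Taylor term `C(n+j,j)·Â_{n+j}·φ^n` is divisible by `u₂^{d−j}`). -/
theorem isPermissibleTwoT_shift_of_X_dvd {d : ℕ} {A : Fin d → MvPowerSeries (Fin 2) k} (h : IsPermissibleTwoT d A)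
    {φ : MvPowerSeries (Fin 2) k} (hφ : (X 1 : MvPowerSeries (Fin 2) k) ∣ φ) : IsPermissibleTwoT d (shift d A φ) := by
  classical
  refine isPermissibleTwoT_of_X_pow_dvd fun j => ?_
  rw [shift_eq_sum]
  refine Finset.dvd_sum fun n hn => ?_
  rw [Finset.mem_range] at hn
  by_cases hnd : n + (j : ℕ) = d
  · -- the top term `C(d,j) · 1 · φ^{d-j}`
    have hnn : n = d - (j : ℕ) := by omega
    rw [hnd, coeff_monicPoly_self, mul_one, hnn]
    exact Dvd.dvd.mul_left (pow_dvd_pow_of_dvd hφ _) _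
  · have hlt : n + (j : ℕ) < d := by omega
    rw [show (monicPoly d A).coeff (n + (j : ℕ)) = A ⟨n + (j : ℕ), hlt⟩ from coeff_monicPoly_of_lt d A ⟨n + (j : ℕ), hlt⟩]
    have h1 := X_pow_dvd_of_isPermissibleTwoT h ⟨n + (j : ℕ), hlt⟩
    have h2 : (X 1 : MvPowerSeries (Fin 2) k) ^ n ∣ φ ^ n := pow_dvd_pow_of_dvd hφ n
    have h3 := mul_dvd_mul h1 h2
    rw [← pow_add, show d - (n + (j : ℕ)) + n = d - (j : ℕ) by omega] at h3
    rw [mul_assoc]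
    exact Dvd.dvd.mul_left h3 _

/-- **ROW TRANSFER**: a WELL-PREPARED label one of whose re-centrings `y ↦ y + φ` has `V(y,u₂)` permissible has `V(y,u₂)` permissible itself
(`d ≥ 1`; `φ(0) = 0` is not even needed — a constant term would make the origin a solvable vertex; general-degree, minimality-free `MonicDescent.isPermissibleTwo_of_wellPrepared_of_recentre`). -/
theorem isPermissibleTwoT_of_wellPrepared_of_isPermissibleTwoT_shift {d : ℕ} (hd : 0 < d) {W : Fin d → MvPowerSeries (Fin 2) k}
    (hWP : WellPrepared d W) {φ : MvPowerSeries (Fin 2) k} (hperm : IsPermissibleTwoT d (shift d W φ)) :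
    IsPermissibleTwoT d W := by
  classical
  set P := shift d W φ with hP
  have hW : W = shift d P (-φ) := by rw [hP, shift_shift_neg]
  by_cases hax : ∀ n, coeff (Finsupp.single 0 n) φ = 0
  · -- `u₂ ∣ φ`: direct
    have hdvd : (X 1 : MvPowerSeries (Fin 2) k) ∣ -φ := by
      rw [dvd_neg, X_dvd_iff]
      intro e he
      have he' : e = Finsupp.single 0 (e 0) := by
        ext i
        obtain rfl | rfl : i = 0 ∨ i = 1 := by fin_cases i <;> simp
        · rw [Finsupp.single_eq_same]
        · rw [Finsupp.single_apply, if_neg (by decide)]; exact he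
      rw [he']
      exact hax _
    rw [hW]
    exact isPermissibleTwoT_shift_of_X_dvd hperm hdvd
  · -- a pure `u₁`-part of order `m ≥ 1`: the axis vertex `(d!·m, 0)` of `W` would be solvable
    exfalso
    push Not at hax
    let m := Nat.find hax
    have hm : coeff (Finsupp.single 0 m) φ ≠ 0 := Nat.find_spec hax
    have hmin : ∀ n < m, coeff (Finsupp.single 0 n) φ = 0 := fun n hn => by
      by_contra h; exact Nat.find_min hax hn h
    refine (not_wellPrepared_shift_of_axis 0 hd P (-φ) m (fun n hn => ?_) ?_ (fun i n _ => ?_)) (hW ▸ hWP)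
    · rw [map_neg, hmin n hn, neg_zero]
    · rw [map_neg, neg_ne_zero]; exact hm
    · by_contra hne
      have := hperm i _ hne
      rw [Finsupp.single_apply, if_neg (by decide)] at this
      have hi := i.2
      omega

end PolyDescent

end Summit.ResolutionOfSingularities.ResolutionOfSingularities.Theorems
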